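import Literature.NumberTheory.Transcendental.RoySmallValueInterpolation
import Mathlib.RingTheory.MvPolynomial.Basic
import Mathlib.Data.Sym.Card
import Mathlib.Data.Finsupp.Multiset
import Mathlib.LinearAlgebra.FiniteDimensional.Lemmas
import Mathlib.LinearAlgebra.Dimension.Constructions
import HarnessLib

/-!
# Roy's small value estimate for `𝔾ₐ × 𝔾ₘ` — Proposition 3.3, the isomorphism `ℂ[X]_L ≅ ℂ^M`

Topic `Literature/NumberTheory/Transcendental`. Fifth instalment of the formalisation of the proof
of Roy 2013, Theorem 1.1 (named fact `roy2013_thm_1_1`, `RoySmallValueEstimates.lean`).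
Source: D. Roy, *A small value estimate for `𝔾ₐ × 𝔾ₘ`*, Mathematika 59 (2013) 333–363 =
arXiv:1301.0663, §3, Proposition 3.3, first assertion (p. 8 of the arXiv text):

> Let `γ = (ξ, η) ∈ 𝒢 = ℂ × ℂˣ`, `L ∈ ℕ`, `M = binom(L+2, 2)`. Then the map
> `ℂ[X]_L → ℂ^M`, `Q ↦ (𝒟ⁱQ(1, γ))_{0 ≤ i < M}` is an isomorphism of `ℂ`-vector spaces.

As printed ("The second assertion is a quantitative version of the first because it implies that
the linear map (3.1) is injective and so is an isomorphism, its domain and codomain having the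
same dimension `M`"), we deduce it from the estimate `l1Norm_le_of_iterate_homD` of
`RoySmallValueInterpolation.lean`:

* `eq_zero_of_iterate_homD_eq_zero` — injectivity;
* `finrank_homogeneousSubmodule_fin_three` — `dim ℂ[X]_L = binom(L+2, 2)` (the monomial basis,
  Mathlib's `basisRestrictSupport`, is indexed by the exponents of degree `L`, in bijection with
  `Sym (Fin 3) L`, counted by stars and bars `Sym.card_sym_eq_choose`);
* `exists_isHomogeneous_iterate_homD_eq` — surjectivity: every `M`-tuple of complex numbers is
  the sequence `(𝒟ⁱQ(1, γ))_{i<M}` of some `Q ∈ ℂ[X]_L`;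
* `exists_isHomogeneous_iterate_homD_eq_of_norm_le` — the same with the length bound of
  Proposition 3.3 for `Q` (the form in which the isomorphism is used in Lemma 3.5 and
  Proposition 6.1 of the paper).

Everything here is proved; no definitions, no new named facts.

## References

* [Roy2013] D. Roy, *A small value estimate for 𝔾ₐ × 𝔾ₘ*, Mathematika 59 (2013), 333–363
  (arXiv:1301.0663), §3, Proposition 3.3.
-/

noncomputable section

open MvPolynomial Finset

namespace Literature.NumberTheory.Transcendental

namespace Roy2013

open Nesterenko

/-! ### Injectivity -/

/-- **Proposition 3.3, injectivity**: if `Q ∈ ℂ[X]_L` and `𝒟ⁱQ(1, γ) = 0` for all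
`i < binom(L+2, 2)`, then `Q = 0` (`γ = (ξ, η)`, `η ≠ 0`). [cite: Roy2013, Proposition 3.3] -/
theorem eq_zero_of_iterate_homD_eq_zero {L : ℕ} {Q : CX} (hQ : Q.IsHomogeneous L) {ξ η : ℂ}
    (hη : η ≠ 0) (h : ∀ n < (L + 2).choose 2, aeval ![1, ξ, η] (homD^[n] Q) = 0) : Q = 0 := by
  by_contra hQ0
  have h1 := l1Norm_le_of_iterate_homD hQ hη (B₀ := 0) (fun n hn => by rw [h n hn, norm_zero])
  rw [mul_zero] at h1
  exact absurd ((maxNorm_le_l1Norm Q).trans h1) (not_le.mpr (maxNorm_pos hQ0))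

/-! ### The dimension of `ℂ[X]_L` -/

/-- `ℂ[X]_L` is the span of the monomials of degree `L` (Mathlib's `restrictSupport`). [folklore] -/
theorem homogeneousSubmodule_eq_restrictSupport (L : ℕ) :
    homogeneousSubmodule (Fin 3) ℂ L = restrictSupport ℂ {d : Fin 3 →₀ ℕ | d.degree = L} :=
  homogeneousSubmodule_eq_finsupp_supported _ _ _

/-- **`dim_ℂ ℂ[X₀, X₁, X₂]_L = binom(L+2, 2)`** (stars and bars).
[cite: Roy2013, §3 (the number `M` of Proposition 3.3)] -/
theorem finrank_homogeneousSubmodule_fin_three (L : ℕ) :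
    Module.finrank ℂ (homogeneousSubmodule (Fin 3) ℂ L) = (L + 2).choose 2 := by
  classical
  have e : ({d : Fin 3 →₀ ℕ | d.degree = L} : Set (Fin 3 →₀ ℕ)) ≃ Sym (Fin 3) L :=
    (Equiv.subtypeEquivRight (fun d => by
      change d.degree = L ↔ d.sum (fun _ => id) = L
      rw [Finsupp.degree_apply]; rfl)).trans (Sym.equivNatSum (α := Fin 3) (n := L)).symm
  rw [homogeneousSubmodule_eq_restrictSupport,
    Module.finrank_eq_nat_card_basis (basisRestrictSupport ℂ _), Nat.card_congr e,
    Nat.card_eq_fintype_card, Sym.card_sym_eq_choose, Fintype.card_fin,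
    show 3 + L - 1 = L + 2 by omega]
  exact Nat.choose_symm_add

/-- `ℂ[X]_L` is finite-dimensional. [folklore] -/
theorem finite_homogeneousSubmodule_fin_three (L : ℕ) :
    Module.Finite ℂ (homogeneousSubmodule (Fin 3) ℂ L) :=
  Module.finite_of_finrank_pos (by rw [finrank_homogeneousSubmodule_fin_three]; exact one_le_choose_two L)

/-! ### Surjectivity -/

/-- **Proposition 3.3, surjectivity**: for `γ = (ξ, η) ∈ ℂ × ℂˣ` and any complex numbers
`v₀, …, v_{M-1}` (`M = binom(L+2, 2)`) there is `Q ∈ ℂ[X]_L` with `𝒟ⁱQ(1, γ) = vᵢ` for all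
`i < M`. With `eq_zero_of_iterate_homD_eq_zero` this is the printed isomorphism
`ℂ[X]_L ≅ ℂ^M`. [cite: Roy2013, Proposition 3.3] -/
theorem exists_isHomogeneous_iterate_homD_eq (L : ℕ) {ξ η : ℂ} (hη : η ≠ 0) (v : ℕ → ℂ) :
    ∃ Q : CX, Q.IsHomogeneous L ∧
      ∀ n < (L + 2).choose 2, aeval ![1, ξ, η] (homD^[n] Q) = v n := by
  set M : ℕ := (L + 2).choose 2 with hM
  set V : Submodule ℂ CX := homogeneousSubmodule (Fin 3) ℂ L with hV
  set f : V →ₗ[ℂ] (Fin M → ℂ) := LinearMap.pi fun i : Fin M =>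
    (MvPolynomial.aeval ![(1 : ℂ), ξ, η]).toLinearMap ∘ₗ
      (((homD : CX →ₗ[ℂ] CX) ^ (i : ℕ)) ∘ₗ V.subtype) with hf_def
  have hf : ∀ (Q : V) (i : Fin M), f Q i = aeval ![1, ξ, η] (homD^[(i : ℕ)] (Q : CX)) := by
    intro Q i
    simp only [hf_def, LinearMap.pi_apply, LinearMap.coe_comp, Function.comp_apply,
      Submodule.coe_subtype, AlgHom.toLinearMap_apply, Module.End.pow_apply, Derivation.coeFn_coe]
  have hinj : Function.Injective f := by
    intro Q₁ Q₂ h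
    rw [← sub_eq_zero]
    have h0 : f (Q₁ - Q₂) = 0 := by rw [map_sub, h, sub_self]
    have hmem : ((Q₁ - Q₂ : V) : CX).IsHomogeneous L := (Q₁ - Q₂).2
    have := eq_zero_of_iterate_homD_eq_zero hmem hη (fun n hn => by
      have := congr_fun h0 ⟨n, hn⟩
      rwa [hf] at this)
    exact (Submodule.coe_eq_zero (x := Q₁ - Q₂)).mp this
  haveI : Module.Finite ℂ V := finite_homogeneousSubmodule_fin_three L
  have hsurj : Function.Surjective f :=
    (LinearMap.injective_iff_surjective_of_finrank_eq_finrank (by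
      rw [hV, finrank_homogeneousSubmodule_fin_three, Module.finrank_pi, Fintype.card_fin])).mp hinj
  obtain ⟨Q, hQ⟩ := hsurj fun i => v i
  refine ⟨Q, Q.2, fun n hn => ?_⟩
  have := congr_fun hQ ⟨n, hn⟩
  rwa [hf] at this

/-- **Proposition 3.3, both halves combined** (the form used in Lemma 3.5 and Proposition 6.1):
for `γ = (ξ, η) ∈ ℂ × ℂˣ` and `v₀, …, v_{M-1}` of modulus `≤ B` there is `Q ∈ ℂ[X]_L` with
`𝒟ⁱQ(1, γ) = vᵢ` (`i < M`) and `𝓛(Q) ≤ (3(1 + |ξ| + |η|⁻¹))^L (4(L+1))^M B`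
(Roy: `𝓛(Q) ≤ c₁(-γ)^L 8^M max |vᵢ|`). [cite: Roy2013, Proposition 3.3] -/
theorem exists_isHomogeneous_iterate_homD_eq_of_norm_le (L : ℕ) {ξ η : ℂ} (hη : η ≠ 0)
    (v : ℕ → ℂ) {B : ℝ} (hv : ∀ n < (L + 2).choose 2, ‖v n‖ ≤ B) :
    ∃ Q : CX, Q.IsHomogeneous L ∧
      (∀ n < (L + 2).choose 2, aeval ![1, ξ, η] (homD^[n] Q) = v n) ∧
      l1Norm Q ≤ (3 * (1 + ‖ξ‖ + ‖η‖⁻¹)) ^ L * (4 * (L + 1) : ℝ) ^ (L + 2).choose 2 * B := by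
  obtain ⟨Q, hQ, hQv⟩ := exists_isHomogeneous_iterate_homD_eq L hη v
  refine ⟨Q, hQ, hQv, l1Norm_le_of_iterate_homD hQ hη fun n hn => ?_⟩
  rw [hQv n hn]
  exact hv n hn

end Roy2013

end Literature.NumberTheory.Transcendental
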